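import Mathlib
import Summits.ValiantsHypothesis.ValiantsHypothesis.Theorems.DivisionGapPerMultiplesHardRichFacesDeep
import Summits.ValiantsHypothesis.ValiantsHypothesis.Theorems.DivisionGapPerMultiplesHardStubTypedDecompositionLL

/-!
# `DivisionGap.PerMultiplesHard` (stmt-ValiantsHypothesis-5068), line `uncharged-face-walk`:
the depth-parametric two-sided Jerrum–Snir count (stubs `deepCount`, `richFacesDeepD`)

For `D ≥ 1`, `m ≥ 3^{D+1}` and every `p ∈ ℝ≥0[x_ij]` on the `m × m` board with
`supp p ⊆ supp per_m`, writing `L = L⁺(p)` (the tree's monotone fan-in-two `complexity`) and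
`e_D = 2^D - 1`:

  `#supp p · 3^{D m} ≤ (L+1)^{e_D} · m! · (m+1)^{e_D} · 2^{D (m - ⌊m/3⌋) + 4 D 2^D}`

(`deepCount`), and its instance for face permanents `per_G = Σ_{σ ⊆ G} x^{μ_σ}`, `#supp per_G = #PM(G)`
(`richFacesDeepD`).  Proof by induction on `D`:
* `D = 1` (`m ≥ 9`): Jerrum–Snir by sub-support with the exact window binomial
  (`RichFacesDeep.exists_sharp_degree`: `#supp p · C(m,d) ≤ L · m!` for some `m < 3d ≤ 2m`) and the
  entropy bound `3^m ≤ (m+1) C(m,d) 2^{m-⌊m/3⌋}` (`SharpChoose.stub_sharpChoose`).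
* `D → D+1` (`m ≥ 3^{D+2}`): all monomials of `p` have unit margins, so the two-sided typed
  decomposition (`TypedDecompositionLL.stub_typedDecompositionLL`, window parameter `3`) writes
  `p = Σ_{t<s} a_t b_t` with `s ≤ L`, `L(a_t) ≤ L`, `L(b_t) ≤ 8L+8`, `a_t` typed with row support
  `m < 3k ≤ 2m`.  Per term (`card_support_mul_le_deep`): the margins split into `𝟙_S/𝟙_T` and
  `𝟙_{Sᶜ}/𝟙_{Tᶜ}` (`RichFacesDeep.margins_split`), both factors are board-compressed
  (`BoardCompression.stub_boardCompression`) to the `k`- and `(m-k)`-boards (both `≥ 3^{D+1}`), the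
  induction hypothesis bounds both, and the arithmetic `arith_step` (`stub_sharpChoose` at `(m,k)`,
  `C(m,k) k! (m-k)! = m!`, `(8L+9)^{e} ≤ 16^{e} (L+1)^{e}`, and the exponent bookkeeping `exp_le`)
  gives `#supp (a_t b_t) · 3^{(D+1)m} ≤ (L+1)^{2e_D} · m! · (m+1)^{2e_D+1} · 2^{…}`; summing the
  `s ≤ L + 1` terms gives the exponent `2e_D + 1 = e_{D+1}`. [cite: JerrumSnir1982, §3–§4.3]
-/

noncomputable section

set_option linter.dupNamespace false

open MvPolynomial Literature.Computability.AlgebraicComplexity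
open scoped NNReal BigOperators
open Literature.Barriers.ValiantsHypothesis
open Summit.ValiantsHypothesis.ValiantsHypothesis.Theorems.DivisionGap.PerMultiplesHard

namespace Summit.ValiantsHypothesis.ValiantsHypothesis.Theorems.DivisionGap.PerMultiplesHard.DeepCount

/-! ### Arithmetic -/

/-- The exponent bookkeeping of the inductive step: with `u = k - ⌊k/3⌋`, `v = (m-k) - ⌊(m-k)/3⌋`,
`X = m - ⌊m/3⌋` one has `u + v ≤ X + 1`, and `D < 2^D`, whence
`D u + 4D2^D + D v + 4D2^D + 4(2^D - 1) + X ≤ (D+1) X + 4(D+1) 2^{D+1}`. [folklore] -/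
theorem exp_le (D m k : ℕ) (hkm : k ≤ m) :
    D * (k - k / 3) + 4 * D * 2 ^ D + (D * ((m - k) - (m - k) / 3) + 4 * D * 2 ^ D) +
        4 * (2 ^ D - 1) + (m - m / 3) ≤ (D + 1) * (m - m / 3) + 4 * (D + 1) * 2 ^ (D + 1) := by
  have hdiv : (k - k / 3) + ((m - k) - (m - k) / 3) ≤ (m - m / 3) + 1 := by omega
  have h1 : D * ((k - k / 3) + ((m - k) - (m - k) / 3)) ≤ D * ((m - m / 3) + 1) :=
    Nat.mul_le_mul_left D hdiv
  have hDP : D < 2 ^ D := Nat.lt_two_pow_self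
  have hP : 2 ^ D - 1 + 1 = 2 ^ D := Nat.sub_add_cancel Nat.one_le_two_pow
  rw [pow_succ]
  generalize k - k / 3 = u at h1 ⊢
  generalize m - k - (m - k) / 3 = v at h1 ⊢
  generalize m - m / 3 = X at h1 ⊢
  generalize 2 ^ D - 1 = e at hP ⊢
  generalize 2 ^ D = P at hDP hP ⊢
  nlinarith [h1, hDP, hP]

/-- **The arithmetic of the inductive step.**  From the depth-`D` bounds for the two compressed
factors (`A` monomials on the `k`-board at cost `La ≤ L`, `B` monomials on the `(m-k)`-board at
cost `Lb ≤ 8L+8`), `#supp (a b) ≤ A · B`, the entropy bound `3^m ≤ (m+1) C(m,k) 2^{m-⌊m/3⌋}`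
(`stub_sharpChoose`), `C(m,k) k! (m-k)! = m!`, `(Lb+1)^e ≤ 16^e (L+1)^e` and an exponent budget
`E`, the depth-`(D+1)` bound for the product. [cite: JerrumSnir1982, §4.3] -/
theorem arith_step {D m k A B AB La Lb L e E₁ E₂ E : ℕ} (hk1 : m < 3 * k) (hk2 : 3 * k ≤ 2 * m)
    (hLa : La ≤ L) (hLb : Lb ≤ 8 * L + 8) (hAB : AB ≤ A * B)
    (hA : A * 3 ^ (D * k) ≤ (La + 1) ^ e * (k.factorial * ((k + 1) ^ e * 2 ^ E₁)))
    (hB : B * 3 ^ (D * (m - k)) ≤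
      (Lb + 1) ^ e * ((m - k).factorial * ((m - k + 1) ^ e * 2 ^ E₂)))
    (hE : E₁ + E₂ + 4 * e + (m - m / 3) ≤ E) :
    AB * 3 ^ ((D + 1) * m) ≤
      (L + 1) ^ (2 * e) * (m.factorial * ((m + 1) ^ (2 * e + 1) * 2 ^ E)) := by
  have hkm : k ≤ m := by omega
  have hLa' : (La + 1) ^ e ≤ (L + 1) ^ e := Nat.pow_le_pow_left (by omega) e
  have hLb' : (Lb + 1) ^ e ≤ 16 ^ e * (L + 1) ^ e := by
    rw [← mul_pow]
    exact Nat.pow_le_pow_left (by omega) e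
  have hk' : (k + 1) ^ e ≤ (m + 1) ^ e := Nat.pow_le_pow_left (by omega) e
  have hmk' : (m - k + 1) ^ e ≤ (m + 1) ^ e := Nat.pow_le_pow_left (by omega) e
  have h3m := SharpChoose.stub_sharpChoose m k hk1 hk2
  have hfact : m.choose k * k.factorial * (m - k).factorial = m.factorial :=
    Nat.choose_mul_factorial_mul_factorial hkm
  have h16 : (16 : ℕ) ^ e = 2 ^ (4 * e) := by
    rw [pow_mul]
    norm_num
  have hDm : (D + 1) * m = D * k + D * (m - k) + m := by
    rw [← Nat.mul_add, Nat.add_sub_of_le hkm]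
    ring
  have h2E : 2 ^ (E₁ + E₂ + 4 * e + (m - m / 3)) ≤ 2 ^ E := Nat.pow_le_pow_right (by norm_num) hE
  calc AB * 3 ^ ((D + 1) * m)
      ≤ A * B * (3 ^ (D * k) * 3 ^ (D * (m - k)) * 3 ^ m) := by
        rw [hDm, pow_add, pow_add]
        exact Nat.mul_le_mul_right _ hAB
    _ = (A * 3 ^ (D * k)) * (B * 3 ^ (D * (m - k))) * 3 ^ m := by ring
    _ ≤ ((La + 1) ^ e * (k.factorial * ((k + 1) ^ e * 2 ^ E₁))) *
          ((Lb + 1) ^ e * ((m - k).factorial * ((m - k + 1) ^ e * 2 ^ E₂))) *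
          ((m + 1) * m.choose k * 2 ^ (m - m / 3)) :=
        Nat.mul_le_mul (Nat.mul_le_mul hA hB) h3m
    _ ≤ ((L + 1) ^ e * (k.factorial * ((m + 1) ^ e * 2 ^ E₁))) *
          ((16 ^ e * (L + 1) ^ e) * ((m - k).factorial * ((m + 1) ^ e * 2 ^ E₂))) *
          ((m + 1) * m.choose k * 2 ^ (m - m / 3)) :=
        Nat.mul_le_mul_right _ (Nat.mul_le_mul
          (Nat.mul_le_mul hLa' (Nat.mul_le_mul_left _ (Nat.mul_le_mul_right _ hk')))
          (Nat.mul_le_mul hLb' (Nat.mul_le_mul_left _ (Nat.mul_le_mul_right _ hmk'))))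
    _ = (L + 1) ^ (2 * e) * ((m.choose k * k.factorial * (m - k).factorial) *
          ((m + 1) ^ (2 * e + 1) * 2 ^ (E₁ + E₂ + 4 * e + (m - m / 3)))) := by
        rw [h16]
        ring
    _ ≤ (L + 1) ^ (2 * e) * (m.factorial * ((m + 1) ^ (2 * e + 1) * 2 ^ E)) := by
        rw [hfact]
        exact Nat.mul_le_mul_left _ (Nat.mul_le_mul_left _ (Nat.mul_le_mul_left _ h2E))

/-! ### The per-term lemma of the inductive step -/

/-- **Per-term bound of the inductive step.**  Assume the depth-`D` bound on every board of size
`≥ 3^{D+1}` (the induction hypothesis `ih`).  On the `m`-board, `m ≥ 3 · 3^{D+1}`, let `a` have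
margins `𝟙_S/𝟙_T` and `b` margins `𝟙_{Sᶜ}/𝟙_{Tᶜ}` with `#S = #T = k`, `m < 3k ≤ 2m`, `L(a) ≤ L`,
`L(b) ≤ 8L + 8`.  Then `#supp (a b) · 3^{(D+1) m} ≤ (L+1)^{2 e_D} · m! · (m+1)^{2 e_D + 1} ·
2^{(D+1)(m - ⌊m/3⌋) + 4 (D+1) 2^{D+1}}`: compress `a` to the `k`-board and `b` to the
`(m-k)`-board (`stub_boardCompression`; both sizes are `≥ 3^{D+1}`), apply `ih` to both,
`#supp (a b) ≤ #supp a · #supp b` (`support_mul_eq`), and `arith_step` with `exp_le`.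
[cite: JerrumSnir1982, §3–§4.3] -/
theorem card_support_mul_le_deep {D m k L : ℕ}
    (ih : ∀ m', 3 ^ (D + 1) ≤ m' → ∀ p' : MvPolynomial (Fin m' × Fin m') ℝ≥0,
      p'.support ⊆ (perPoly (Fin m') ℝ≥0).support →
      p'.support.card * 3 ^ (D * m') ≤ (complexity p' + 1) ^ (2 ^ D - 1) *
        (m'.factorial * ((m' + 1) ^ (2 ^ D - 1) * 2 ^ (D * (m' - m' / 3) + 4 * D * 2 ^ D))))
    (hm : 3 * 3 ^ (D + 1) ≤ m) (hk1 : m < 3 * k) (hk2 : 3 * k ≤ 2 * m)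
    (S T : Finset (Fin m)) (hS : S.card = k) (hT : T.card = k)
    {a b : MvPolynomial (Fin m × Fin m) ℝ≥0}
    (ha : ∀ mo ∈ a.support, (∀ i, ∑ j, mo (i, j) = if i ∈ S then 1 else 0) ∧
      (∀ j, ∑ i, mo (i, j) = if j ∈ T then 1 else 0))
    (hb : ∀ mo ∈ b.support, (∀ i, ∑ j, mo (i, j) = if i ∈ Sᶜ then 1 else 0) ∧
      (∀ j, ∑ i, mo (i, j) = if j ∈ Tᶜ then 1 else 0))
    (hLa : complexity a ≤ L) (hLb : complexity b ≤ 8 * L + 8) :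
    (a * b).support.card * 3 ^ ((D + 1) * m) ≤ (L + 1) ^ (2 * (2 ^ D - 1)) *
      (m.factorial * ((m + 1) ^ (2 * (2 ^ D - 1) + 1) *
        2 ^ ((D + 1) * (m - m / 3) + 4 * (D + 1) * 2 ^ (D + 1)))) := by
  classical
  obtain ⟨a', hsuba, hcarda, hcompla⟩ :=
    BoardCompression.stub_boardCompression m k S T a hS hT ha
  have hSc : Sᶜ.card = m - k := by rw [Finset.card_compl, Fintype.card_fin, hS]
  have hTc : Tᶜ.card = m - k := by rw [Finset.card_compl, Fintype.card_fin, hT]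
  obtain ⟨b', hsubb, hcardb, hcomplb⟩ :=
    BoardCompression.stub_boardCompression m (m - k) Sᶜ Tᶜ b hSc hTc hb
  have hka : 3 ^ (D + 1) ≤ k := by omega
  have hkb : 3 ^ (D + 1) ≤ m - k := by omega
  have hA := ih k hka a' hsuba
  have hB := ih (m - k) hkb b' hsubb
  rw [hcarda] at hA
  rw [hcardb] at hB
  have hAB : (a * b).support.card ≤ a.support.card * b.support.card := by
    rw [JerrumSnir.support_mul_eq]
    exact Finset.card_add_le
  exact arith_step hk1 hk2 (hcompla.trans hLa) (hcomplb.trans hLb) hAB hA hB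
    (exp_le D m k (by omega))

/-! ### The stubs -/

/-- **deepCount — the depth-parametric two-sided Jerrum–Snir count (registered stub).**  For
`D ≥ 1`, `m ≥ 3^{D+1}` and `supp p ⊆ supp per_m` (over `ℝ≥0`, `L = L⁺(p)`, `e_D = 2^D - 1`):
`#supp p · 3^{D m} ≤ (L+1)^{e_D} · m! · (m+1)^{e_D} · 2^{D (m - ⌊m/3⌋) + 4 D 2^D}`.
Induction on `D`: the base is Jerrum–Snir by sub-support with the exact binomial
(`exists_sharp_degree`, `stub_sharpChoose`); the step decomposes `p = Σ_{t<s} a_t b_t` two-sidedly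
(`stub_typedDecompositionLL`, `s ≤ L`, `L(a_t) ≤ L`, `L(b_t) ≤ 8L+8`), bounds every term by
`card_support_mul_le_deep` (after `margins_split`), and sums (`support_sum`, no cancellation).
[cite: JerrumSnir1982, §3–§4.3] -/
theorem deepCount : ∀ (D : ℕ), 1 ≤ D → ∀ (m : ℕ), 3 ^ (D + 1) ≤ m →
    ∀ (p : MvPolynomial (Fin m × Fin m) ℝ≥0), p.support ⊆ (perPoly (Fin m) ℝ≥0).support →
      p.support.card * 3 ^ (D * m) ≤ (complexity p + 1) ^ (2 ^ D - 1) *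
        (m.factorial * ((m + 1) ^ (2 ^ D - 1) * 2 ^ (D * (m - m / 3) + 4 * D * 2 ^ D))) := by
  intro D hD
  induction D, hD using Nat.le_induction with
  | base =>
    intro m hm p hp
    have hm3 : 3 ≤ m := le_trans (by norm_num) hm
    obtain ⟨d, hd1, hd2, hcount⟩ := RichFacesDeep.exists_sharp_degree hm3 p hp
    have h3 := SharpChoose.stub_sharpChoose m d hd1 hd2
    have hE : 1 * (m - m / 3) + 4 * 1 * 2 ^ 1 = (m - m / 3) + 8 := by norm_num
    have h21 : (2 : ℕ) ^ 1 - 1 = 1 := rfl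
    rw [hE, h21, pow_one, pow_one, one_mul]
    calc p.support.card * 3 ^ m
        ≤ p.support.card * ((m + 1) * m.choose d * 2 ^ (m - m / 3)) := Nat.mul_le_mul_left _ h3
      _ = (m + 1) * 2 ^ (m - m / 3) * (p.support.card * m.choose d) := by ring
      _ ≤ (m + 1) * 2 ^ (m - m / 3) * (complexity p * m.factorial) :=
          Nat.mul_le_mul_left _ hcount
      _ = complexity p * (m.factorial * ((m + 1) * (2 ^ (m - m / 3) * 1))) := by ring
      _ ≤ (complexity p + 1) * (m.factorial * ((m + 1) * (2 ^ (m - m / 3) * 2 ^ 8))) :=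
          Nat.mul_le_mul (Nat.le_succ _) (Nat.mul_le_mul_left _ (Nat.mul_le_mul_left _
            (Nat.mul_le_mul_left _ Nat.one_le_two_pow)))
      _ = (complexity p + 1) * (m.factorial * ((m + 1) * 2 ^ (m - m / 3 + 8))) := by
          rw [pow_add]
  | succ D hD ih =>
    intro m hm p hp
    classical
    have hm' : 3 * 3 ^ (D + 1) ≤ m := by rw [pow_succ] at hm; omega
    have h3P : 3 ≤ 3 ^ (D + 1) :=
      calc 3 = 3 ^ 1 := (pow_one 3).symm
        _ ≤ 3 ^ (D + 1) := Nat.pow_le_pow_right (by norm_num) (by omega)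
    have hm3 : 3 ≤ m := by omega
    -- all monomials of `p` have unit margins
    have hg : ∀ mo ∈ p.support, (∀ i, ∑ j, mo (i, j) = 1) ∧ (∀ j, ∑ i, mo (i, j) = 1) := by
      intro mo hmo
      obtain ⟨σ, rfl⟩ := (JerrumSnir.mem_support_perPoly ℝ≥0).1 (hp hmo)
      exact ⟨fun i => rowCount_permMonomial σ i, fun j => colCount_permMonomial σ j⟩
    obtain ⟨s, hsL, a, b, hpab, ht⟩ := TypedDecompositionLL.stub_typedDecompositionLL m 3 le_rfl
      hm3 p (fun _ => 1) (fun _ => 1) hg (fun _ => one_ne_zero)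
    have he : 2 ^ (D + 1) - 1 = 2 * (2 ^ D - 1) + 1 := by
      have := Nat.one_le_two_pow (n := D)
      rw [pow_succ]
      omega
    rw [he]
    set M := m.factorial * ((m + 1) ^ (2 * (2 ^ D - 1) + 1) *
      2 ^ ((D + 1) * (m - m / 3) + 4 * (D + 1) * 2 ^ (D + 1)))
    -- every term is bounded by the per-term lemma
    have hterm : ∀ t, (a t * b t).support.card * 3 ^ ((D + 1) * m) ≤
        (complexity p + 1) ^ (2 * (2 ^ D - 1)) * M := by
      intro t
      obtain ⟨hLa, hLb, ρ, γ, hty, hk1, hk2⟩ := ht t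
      by_cases ha0 : a t = 0
      · simp [ha0]
      by_cases hb0 : b t = 0
      · simp [hb0]
      have hsub : (a t * b t).support ⊆ p.support := by
        refine support_subset_of_eq_add (q := ∑ t' ∈ Finset.univ.erase t, a t' * b t') ?_
        rw [Finset.add_sum_erase _ (fun t' => a t' * b t') (Finset.mem_univ t)]
        exact hpab
      obtain ⟨haS, hbS, hTS⟩ :=
        RichFacesDeep.margins_split ha0 hb0 (fun mo hmo => hg mo (hsub hmo)) hty
      exact card_support_mul_le_deep ih hm' hk1 hk2 _ _ rfl hTS haS hbS hLa hLb
    -- no cancellation: `#supp p ≤ Σ_t #supp (a_t b_t)`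
    have hsum : p.support.card ≤ ∑ t, (a t * b t).support.card := by
      conv_lhs => rw [hpab]
      exact (Finset.card_le_card support_sum).trans Finset.card_biUnion_le
    calc p.support.card * 3 ^ ((D + 1) * m)
        ≤ (∑ t, (a t * b t).support.card) * 3 ^ ((D + 1) * m) := Nat.mul_le_mul_right _ hsum
      _ = ∑ t, (a t * b t).support.card * 3 ^ ((D + 1) * m) := Finset.sum_mul _ _ _
      _ ≤ ∑ _t : Fin s, (complexity p + 1) ^ (2 * (2 ^ D - 1)) * M :=
          Finset.sum_le_sum fun t _ => hterm t
      _ = s * ((complexity p + 1) ^ (2 * (2 ^ D - 1)) * M) := by simp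
      _ ≤ (complexity p + 1) * ((complexity p + 1) ^ (2 * (2 ^ D - 1)) * M) :=
          Nat.mul_le_mul_right _ (by omega)
      _ = (complexity p + 1) ^ (2 * (2 ^ D - 1) + 1) * M := by ring

/-- **richFacesDeepD — the depth-parametric deep richness engine for face permanents (registered
stub).**  For `D ≥ 1`, `n ≥ 3^{D+1}` and every `G ⊆ [n]²`, with `per_G = Σ_{σ ⊆ G} x^{μ_σ}`,
`#PM(G)` the number of permutations inside `G`, `L = L⁺(per_G)` and `e_D = 2^D - 1`:
`#PM(G) · 3^{D n} ≤ (L+1)^{e_D} · n! · (n+1)^{e_D} · 2^{D (n - ⌊n/3⌋) + 4 D 2^D}` — `deepCount`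
applied to `per_G`, whose support is the injective image `μ(PM(G)) ⊆ supp per_n`
(`mem_support_sum_monomial_iff`, `permMonomial_injective`, `mem_support_perPoly`).
[cite: JerrumSnir1982, §3–§4.3] -/
theorem richFacesDeepD : ∀ (D : ℕ), 1 ≤ D → ∀ (n : ℕ), 3 ^ (D + 1) ≤ n →
    ∀ G : Finset (Fin n × Fin n),
      ((Finset.univ : Finset (Equiv.Perm (Fin n))).filter (fun σ => ∀ i, (σ i, i) ∈ G)).card *
          3 ^ (D * n) ≤
        (complexity (∑ σ ∈ (Finset.univ : Finset (Equiv.Perm (Fin n))).filter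
            (fun σ => ∀ i, (σ i, i) ∈ G), monomial (permMonomial σ) (1 : ℝ≥0)) + 1) ^
            (2 ^ D - 1) *
          (n.factorial * ((n + 1) ^ (2 ^ D - 1) * 2 ^ (D * (n - n / 3) + 4 * D * 2 ^ D))) := by
  intro D hD n hn G
  classical
  set PM := (Finset.univ : Finset (Equiv.Perm (Fin n))).filter (fun σ => ∀ i, (σ i, i) ∈ G)
  set g : MvPolynomial (Fin n × Fin n) ℝ≥0 := ∑ σ ∈ PM, monomial (permMonomial σ) (1 : ℝ≥0)
  -- `supp g = μ(PM(G))`: distinct exponents, coefficients `1`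
  have hmem : ∀ d, d ∈ g.support ↔ ∃ σ ∈ PM, permMonomial σ = d := fun d =>
    BoardCompression.mem_support_sum_monomial_iff permMonomial_injective.injOn
      (fun _ _ => one_ne_zero) d
  have hsupp : g.support = PM.image permMonomial := by
    ext d
    rw [hmem, Finset.mem_image]
  have hcard : g.support.card = PM.card := by
    rw [hsupp, Finset.card_image_of_injective _ permMonomial_injective]
  have hsub : g.support ⊆ (perPoly (Fin n) ℝ≥0).support := fun d hd => by
    obtain ⟨σ, -, rfl⟩ := (hmem d).1 hd
    exact (JerrumSnir.mem_support_perPoly ℝ≥0).2 ⟨σ, rfl⟩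
  calc PM.card * 3 ^ (D * n) = g.support.card * 3 ^ (D * n) := by rw [hcard]
    _ ≤ _ := deepCount D hD n hn g hsub

end Summit.ValiantsHypothesis.ValiantsHypothesis.Theorems.DivisionGap.PerMultiplesHard.DeepCount

end
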